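import Summits.CriticalPhenomena.PercolationContinuityZ3.Theses.PercNecklaceBackbone
import Summits.CriticalPhenomena.PercolationContinuityZ3.Theorems.PercNearOneGluingNoHeavyLowerTailCSHTheoremOne
import Summits.CriticalPhenomena.PercolationContinuityZ3.Theorems.PercNecklaceBackboneNoBackboneBirthGlue
import Summits.CriticalPhenomena.PercolationContinuityZ3.Theorems.PercNecklaceBackboneTruncatedSusceptibilityFiniteOfThetaOfSubquadraticSusceptibility
import HarnessLib

/-!
# `PercNecklaceBackbone.Thesis` (stmt-CriticalPhenomena-6362) — SETTLED after continuity

Item `stmt-CriticalPhenomena-6362` of route `CriticalPhenomena/PercNecklaceBackbone` (TARGET (rank 0)): `NoBackbone ∧ L` — no backbone at `p_c` and finite truncated susceptibility on `{θ > 0}`.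

Both conjuncts are derived in the tree from the sub-problem statement (`NoBackboneBirth.noBackbone_of_percolationContinuityZ3`, `TruncatedSusceptibilityFiniteOfTheta.TruncatedSusceptibilityFiniteOfTheta_of_percolationContinuity`); p205010 discharges it.

builds on p205010 (kernel theorem, internal audit signed; external expert review pending) — USED (`CSH.percolationContinuityZ3_holds`).  RSW3 lane, lead gen 28 (prover-prim-rsw3-lead-g28-0):
'after continuity — the ledger harvest'.
References: G. Kozma, N. Nitzan (2024), Thm. 6 / Conj. 3 [KozmaNitzan2024]; G. Grimmett, *Percolation* (1999), §8 [GrimmettPercolation1999].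
-/

noncomputable section

namespace Summit.CriticalPhenomena.PercolationContinuityZ3.Theorems

namespace PercNecklaceBackboneThesis

open MeasureTheory Literature.Probability.Percolation Literature.Probability.LatticeModels

/-- **`PercNecklaceBackbone.Thesis` (stmt-CriticalPhenomena-6362), settled.**  `⟨noBackbone_of_percolationContinuityZ3 _, TruncatedSusceptibilityFiniteOfTheta_of_percolationContinuity _⟩` at p205010.
[cite: KozmaNitzan2024, Thm. 6 with Conj. 3 (p. 15)] -/
theorem thesis_proof : Summit.CriticalPhenomena.PercolationContinuityZ3.Theses.PercNecklaceBackbone.Thesis := by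
  unfold Summit.CriticalPhenomena.PercolationContinuityZ3.Theses.PercNecklaceBackbone.Thesis
  exact ⟨NoBackboneBirth.noBackbone_of_percolationContinuityZ3 CSH.percolationContinuityZ3_holds,
    TruncatedSusceptibilityFiniteOfTheta.TruncatedSusceptibilityFiniteOfTheta_of_percolationContinuity
      CSH.percolationContinuityZ3_holds⟩

end PercNecklaceBackboneThesis

end Summit.CriticalPhenomena.PercolationContinuityZ3.Theorems

end
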